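import Literature.NumberTheory.ComplexMultiplication.ReflexNormIdeles
import Literature.NumberTheory.Adeles.CompactSubgroupStabilisesLattice
import HarnessLib

/-!
# Integral adèles have integral coordinates: `e⁻¹(𝓞̂_K) ⊆ ẑ ⊗ 𝓞_K` for `e : 𝔸_{ℚ,f} ⊗_ℚ K ≅ 𝔸_{K,f}`
# ([Cassels–Fröhlich] Ch. II §§10–11, §14: `𝓞_K ⊗ ℤ_p ≅ ∏_{w∣p} 𝓞_w`, `𝔸_{K,f} = 𝔸_{ℚ,f} ⊗ K`)

Topic `NumberTheory/Adeles`; namespace `Literature.NumberTheory.Adeles`.  THEOREMS ONLY: no definition, no named fact, no instance,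
no `sorry` (net Literature debt 0).  Cell hodgecm-mathlib (D-0151), #60 road (row I-7 `SiegelS1`; lead A-p05), leaf R60-35c — the
«named input» of ★ R60-35b `SiegelCMLatticeReciprocityConverse` made a theorem; a banked GENERIC leaf (director s86 (2)(b)).
HC_CM is proved only modulo the printed citations until rung 0 closes.

## What is proved

For a number field `K`, the identification `e = ratFiniteAdeleTensorEquiv K : 𝔸_{ℚ,f} ⊗_ℚ K ≃ 𝔸_{K,f}` (★ `ReflexNormIdeles`, the FLT
base change `baseChangeAlgEquiv` after the symmetry of `⊗`) and the `𝔸_{ℚ,f}`-basis `1 ⊗ β` of `𝔸_{ℚ,f} ⊗ K` attached to a `ℚ`-basis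
`β` of `K` (Mathlib `Algebra.TensorProduct.basis`):

* §1 LOCAL (`coord_mem_adicCompletionIntegers_of_forall_extension`): for an `𝓞_ℚ`-basis `b` of `𝓞_K`, a prime `p` and `c ∈ ℚ_p^κ`,
  if `Σ_k b_k · c_k ∈ 𝒪_w` for every `w ∣ p` then every `c_k ∈ ℤ_p` — the integral base change
  `𝓞_K ⊗_{𝓞_ℚ} ℤ_p ≅ ∏_{w∣p} 𝒪_w` (★ FLT-port `adicCompletion.integerBaseChangeLinearEquiv_bijOn`, [CasselsFrohlichANT1967] II §10
  Thm. (10.2)) read through the coordinate functionals `b*_k ⊗ 1`.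
* §2 GLOBAL (`repr_ratFiniteAdeleTensorEquiv_symm_mem_integralFiniteAdeles`, `mem_integralAdeles_iff_forall_repr_mem`): for the
  INTEGRAL basis `β = integralBasis K`, **`u ∈ 𝓞̂_K` (integral at every place) iff all coordinates of `e⁻¹(u)` lie in `ẑ`** — i.e.
  `e(ẑ ⊗_ℤ 𝓞_K) = 𝓞̂_K = ∏_w 𝒪_w` ([CasselsFrohlichANT1967] II §11, §14; `u_w = Σ_k β_k · (z_k)_p` by ★ `ratFiniteAdeleTensorEquiv_tmul`
  and ★ `FiniteAdeleRing.mapSemialgHom_apply`).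
* §3 ANY BASIS (`exists_nat_mul_repr_ratFiniteAdeleTensorEquiv_symm_mem`): in an arbitrary `ℚ`-basis `b₁` of `K` the coordinates
  of `𝓞̂_K` have BOUNDED DENOMINATORS: `∃ d ≥ 1, ∀ u ∈ 𝓞̂_K, d · (1 ⊗ b₁)^*_k(e⁻¹ u) ∈ ẑ` (change of basis through the rational matrix
  `b₁.repr ∘ β`).
This is the finiteness/compactness input behind «adelic lattices are determined by their rational points» (★ R60-35b's
hypothesis `hbdd`, discharged in `ModuliOfAbelianVarieties/SiegelCMLatticeOfRationalReading`).

## References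
* [CasselsFrohlichANT1967] J. W. S. Cassels, A. Fröhlich (eds.), *Algebraic Number Theory* (1967), Ch. II §10 Thm. (10.2), §11, §14
  Lemma (14.2).
* [FLTProject2025] K. Buzzard, R. Taylor et al., *FLT* (Lean), `FLT/DedekindDomain/Completion/BaseChange.lean` (tree port
  `AdelicBaseChange/CompletionBaseChange`).
-/

set_option autoImplicit false

noncomputable section

open NumberField IsDedekindDomain IsDedekindDomain.HeightOneSpectrum
open scoped TensorProduct

namespace Literature.NumberTheory.Adeles

open Literature.NumberTheory.ComplexMultiplication (ratFiniteAdeleTensorEquiv ratFiniteAdeleTensorEquiv_tmul)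
open Literature.NumberTheory.Automorphic (integralFiniteAdeles mem_integralFiniteAdeles_iff)

variable (K : Type) [Field K] [NumberField K]

/-! ### §1. Local: coordinates of `∏_{w∣p} 𝒪_w` in an `𝓞_ℚ`-basis of `𝓞_K` are `p`-integral -/

/-- **Local integrality of coordinates** (`𝓞_K ⊗ ℤ_p ≅ ∏_{w∣p} 𝒪_w` read in coordinates): for an `𝓞_ℚ`-basis `b` of `𝓞_K`, a finite
place `p` of `ℚ` and `c ∈ ℚ_p^κ`, if `Σ_k b_k · c_k` lies in `𝒪_w` for every `w ∣ p`, then every `c_k ∈ ℤ_p`.  Proof: the element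
`T = Σ_k b_k ⊗ c_k ∈ 𝓞_K ⊗_{𝓞_ℚ} ℚ_p` is sent by ★ `integerBaseChangeLinearEquiv` into `∏_{w∣p} 𝒪_w`, hence
(★ `integerBaseChangeLinearEquiv_bijOn`) comes from `𝓞_K ⊗ ℤ_p` (★ `tensorCoe`), and the coordinate functional `b*_k ⊗ 1` maps
`𝓞_K ⊗ ℤ_p` into `ℤ_p` and `T` to `c_k`.
[cite: CasselsFrohlichANT1967, Ch. II §10 Thm. (10.2)] [cite: FLTProject2025, FLT/DedekindDomain/Completion/BaseChange.lean · integerBaseChangeLinearEquiv_bijOn] -/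
theorem coord_mem_adicCompletionIntegers_of_forall_extension {κ : Type} [Fintype κ] [DecidableEq κ]
    (b : Module.Basis κ (𝓞 ℚ) (𝓞 K)) (p : HeightOneSpectrum (𝓞 ℚ)) (c : κ → adicCompletion ℚ p)
    (h : ∀ w : p.Extension (𝓞 K),
      (∑ k, algebraMap K (adicCompletion K w.1) ((b k : 𝓞 K) : K) *
          algebraMap (adicCompletion ℚ p) (adicCompletion K w.1) (c k)) ∈ adicCompletionIntegers K w.1) :
    ∀ k, c k ∈ adicCompletionIntegers ℚ p := by
  classical
  -- pin the `𝓞 ℚ`-algebra structure on `ℚ_p` to the one the base-change packet uses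
  letI instA : Algebra (𝓞 ℚ) (adicCompletion ℚ p) :=
    IsDedekindDomain.HeightOneSpectrum.instAlgebraAdicCompletion (K := ℚ) (S := 𝓞 ℚ) (v := p)
  set T : 𝓞 K ⊗[𝓞 ℚ] adicCompletion ℚ p := ∑ k, b k ⊗ₜ[𝓞 ℚ] c k with hT
  have hbij := adicCompletion.integerBaseChangeLinearEquiv_bijOn (K := ℚ) (L := K) (B := 𝓞 K) (v := p)
  -- `iBCLE T ∈ ∏ 𝒪_w`
  have hTw : ∀ w : p.Extension (𝓞 K),
      adicCompletion.integerBaseChangeLinearEquiv ℚ K (𝓞 K) p T w ∈ adicCompletionIntegers K w.1 := by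
    intro w
    have : adicCompletion.integerBaseChangeLinearEquiv ℚ K (𝓞 K) p T w =
        ∑ k, algebraMap K (adicCompletion K w.1) ((b k : 𝓞 K) : K) *
          algebraMap (adicCompletion ℚ p) (adicCompletion K w.1) (c k) := by
      simp only [hT, map_sum, Finset.sum_apply, adicCompletion.integerBaseChangeLinearEquiv_tmul_apply]
      refine Finset.sum_congr rfl fun k _ => ?_
      congr 1
    rw [this]
    exact h w
  have hTmem : adicCompletion.integerBaseChangeLinearEquiv ℚ K (𝓞 K) p T ∈
      (↑(Submodule.pi Set.univ fun w : p.Extension (𝓞 K) => adicCompletion.integerSubmodule K w.1) :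
        Set ((w : p.Extension (𝓞 K)) → adicCompletion K w.1)) := by
    rw [SetLike.mem_coe, Submodule.mem_pi]
    exact fun w _ => hTw w
  obtain ⟨y, hy, hyT⟩ := hbij.surjOn hTmem
  have hyT' : y = T := (adicCompletion.integerBaseChangeLinearEquiv ℚ K (𝓞 K) p).injective hyT
  subst hyT'
  obtain ⟨z, hz⟩ := hy
  intro k
  -- the coordinate functional `coordₖ (x ⊗ y) = (b.coord k x) • y`
  let coord : 𝓞 K ⊗[𝓞 ℚ] adicCompletion ℚ p →ₗ[𝓞 ℚ] adicCompletion ℚ p :=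
    (TensorProduct.lid (𝓞 ℚ) (adicCompletion ℚ p)).toLinearMap ∘ₗ (b.coord k).rTensor (adicCompletion ℚ p)
  have hcoord : ∀ (x : 𝓞 K) (y : adicCompletion ℚ p), coord (x ⊗ₜ y) = (b.coord k x) • y := fun x y => by
    simp only [coord, LinearMap.coe_comp, Function.comp_apply, LinearMap.rTensor_tmul, LinearEquiv.coe_toLinearMap,
      TensorProduct.lid_tmul]
  -- `coord T = c k`
  have hcT : coord (∑ j, b j ⊗ₜ[𝓞 ℚ] c j) = c k := by
    rw [map_sum]
    simp only [hcoord, Module.Basis.coord_apply, Module.Basis.repr_self]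
    rw [Finset.sum_eq_single k]
    · rw [Finsupp.single_eq_same, one_smul]
    · intro j _ hj
      rw [Finsupp.single_eq_of_ne (Ne.symm hj), zero_smul]
    · intro hk; exact absurd (Finset.mem_univ k) hk
  -- `coord (tensorCoe z) ∈ ℤ_p`
  have hcz : ∀ z : 𝓞 K ⊗[𝓞 ℚ] adicCompletionIntegers ℚ p,
      coord (adicCompletionIntegers.tensorCoe ℚ (𝓞 K) p z) ∈ adicCompletionIntegers ℚ p := by
    intro z
    induction z using TensorProduct.induction_on with
    | zero => simp only [map_zero]; exact zero_mem _
    | tmul x o =>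
      rw [adicCompletionIntegers.tensorCoe_tmul, hcoord, Algebra.smul_def]
      exact mul_mem (coe_algebraMap_mem (𝓞 ℚ) ℚ p (b.coord k x)) o.2
    | add x y hx hy => simp only [map_add]; exact add_mem hx hy
  have := hcz z
  rw [hz] at this
  rwa [hcT] at this


/-! ### §2. Global: integral adèles have integral coordinates in an integral basis -/

/-- Components of a finite sum of finite adèles. [cite: CasselsFrohlichANT1967, Ch. II §14] -/
private theorem finiteAdele_sum_apply' {ι : Type*} (s : Finset ι) (f : ι → FiniteAdeleRing (𝓞 K) K)
    (w : HeightOneSpectrum (𝓞 K)) : (∑ i ∈ s, f i) w = ∑ i ∈ s, f i w := by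
  classical
  induction s using Finset.induction_on with
  | empty => rw [Finset.sum_empty, Finset.sum_empty]; rfl
  | insert a s ha ih => rw [Finset.sum_insert ha, Finset.sum_insert ha, ← ih]; rfl

/-- **Integral adèles have integral coordinates in an integral basis**: for `u ∈ 𝓞̂_K = ∏_w 𝒪_w` the coordinates of
`e⁻¹(u) ∈ 𝔸_{ℚ,f} ⊗_ℚ K` (`e = ratFiniteAdeleTensorEquiv K`) in the `𝔸_{ℚ,f}`-basis `1 ⊗ β`, `β = integralBasis K`, lie in `ẑ`:
place by place `u_w = Σ_k β_k · (z_k)_p` (`w ∣ p`; ★ `ratFiniteAdeleTensorEquiv_tmul`, ★ `FiniteAdeleRing.mapSemialgHom_apply`) and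
§1 applies (the `𝓞_ℚ`-basis of `𝓞_K` is `RingOfIntegers.basis K` transported along `𝓞_ℚ ≃ ℤ`).
[cite: CasselsFrohlichANT1967, Ch. II §11 and §14 Lemma (14.2)] -/
theorem repr_ratFiniteAdeleTensorEquiv_symm_mem_integralFiniteAdeles {u : FiniteAdeleRing (𝓞 K) K}
    (hu : ∀ w : HeightOneSpectrum (𝓞 K), u w ∈ w.adicCompletionIntegers K)
    (k : Module.Free.ChooseBasisIndex ℤ (𝓞 K)) :
    (Algebra.TensorProduct.basis (FiniteAdeleRing (𝓞 ℚ) ℚ) (integralBasis K)).repr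
        ((ratFiniteAdeleTensorEquiv K).symm u) k ∈ integralFiniteAdeles ℚ := by
  classical
  set β := integralBasis K with hβ
  set B := Algebra.TensorProduct.basis (FiniteAdeleRing (𝓞 ℚ) ℚ) β with hB
  set z := (ratFiniteAdeleTensorEquiv K).symm u with hzdef
  set zc : Module.Free.ChooseBasisIndex ℤ (𝓞 K) → FiniteAdeleRing (𝓞 ℚ) ℚ := fun l => B.repr z l with hzc
  -- `z = Σ_l zc_l ⊗ β_l`
  have hz : z = ∑ l, zc l ⊗ₜ[ℚ] β l := by
    calc z = B.repr.symm (B.repr z) := (B.repr.symm_apply_apply z).symm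
      _ = B.repr.symm (∑ l, Finsupp.single l (zc l)) := by rw [hzc, Finsupp.univ_sum_single]
      _ = ∑ l, B.repr.symm (Finsupp.single l (zc l)) := map_sum _ _ _
      _ = ∑ l, zc l ⊗ₜ[ℚ] β l := Finset.sum_congr rfl fun l _ => by
          rw [hB, Algebra.TensorProduct.basis_repr_symm_apply, Module.Basis.repr_symm_single_one]
  -- `u = Σ_l (β_l) · map(zc_l)`
  have hu' : u = ∑ l, algebraMap K (FiniteAdeleRing (𝓞 K) K) (β l) *
      FiniteAdeleRing.mapSemialgHom (𝓞 ℚ) ℚ K (𝓞 K) (zc l) := by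
    calc u = ratFiniteAdeleTensorEquiv K z := by rw [hzdef, RingEquiv.apply_symm_apply]
      _ = ∑ l, ratFiniteAdeleTensorEquiv K (zc l ⊗ₜ[ℚ] β l) := by rw [hz, map_sum]
      _ = _ := Finset.sum_congr rfl fun l _ => by rw [ratFiniteAdeleTensorEquiv_tmul]
  -- an `𝓞 ℚ`-basis of `𝓞 K` with the same underlying vectors
  let b : Module.Basis (Module.Free.ChooseBasisIndex ℤ (𝓞 K)) (𝓞 ℚ) (𝓞 K) :=
    (RingOfIntegers.basis K).mapCoeffs Rat.ringOfIntegersEquiv.symm (fun c x => by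
      rw [Algebra.smul_def, eq_intCast Rat.ringOfIntegersEquiv.symm c, map_intCast, zsmul_eq_mul])
  have hbβ : ∀ l, ((b l : 𝓞 K) : K) = β l := fun l => by
    rw [Module.Basis.mapCoeffs_apply, hβ, integralBasis_apply]
  -- integrality at every `p`
  rw [mem_integralFiniteAdeles_iff]
  intro p
  refine coord_mem_adicCompletionIntegers_of_forall_extension K b p (fun l => zc l p) ?_ k
  rintro ⟨w₁, hw₁⟩
  subst hw₁
  have hcomp : u w₁ = ∑ l, algebraMap K (adicCompletion K w₁) ((b l : 𝓞 K) : K) *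
      HeightOneSpectrum.Extension.adicCompletionSemialgHom ℚ K
        (⟨w₁, rfl⟩ : (HeightOneSpectrum.under (𝓞 ℚ) w₁).Extension (𝓞 K)) (zc l (HeightOneSpectrum.under (𝓞 ℚ) w₁)) := by
    rw [hu', finiteAdele_sum_apply']
    refine Finset.sum_congr rfl fun l _ => ?_
    rw [Literature.NumberTheory.Automorphic.FiniteAdeleRing.mul_apply', hbβ, FiniteAdeleRing.mapSemialgHom_apply]
    rfl
  have := hu w₁
  rw [hcomp] at this
  exact this


/-- **Conversely, integral coordinates give an integral adèle**: if all coordinates of `e⁻¹(u)` in the integral basis lie in `ẑ`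
then `u ∈ 𝓞̂_K` (`u_w = Σ_k β_k · (z_k)_p` with `β_k ∈ 𝓞_K` and `(z_k)_p ∈ ℤ_p ↦ 𝒪_w`, ★ FLT-port
`adicCompletionSemialgHom_image_adicCompletionIntegers`). [cite: CasselsFrohlichANT1967, Ch. II §11 and §14 Lemma (14.2)] -/
theorem mem_adicCompletionIntegers_of_forall_repr_mem {u : FiniteAdeleRing (𝓞 K) K}
    (hz : ∀ k, (Algebra.TensorProduct.basis (FiniteAdeleRing (𝓞 ℚ) ℚ) (integralBasis K)).repr
        ((ratFiniteAdeleTensorEquiv K).symm u) k ∈ integralFiniteAdeles ℚ)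
    (w : HeightOneSpectrum (𝓞 K)) : u w ∈ w.adicCompletionIntegers K := by
  classical
  set β := integralBasis K with hβ
  set B := Algebra.TensorProduct.basis (FiniteAdeleRing (𝓞 ℚ) ℚ) β with hB
  set z := (ratFiniteAdeleTensorEquiv K).symm u with hzdef
  set zc : Module.Free.ChooseBasisIndex ℤ (𝓞 K) → FiniteAdeleRing (𝓞 ℚ) ℚ := fun l => B.repr z l with hzc
  have hzsum : z = ∑ l, zc l ⊗ₜ[ℚ] β l := by
    calc z = B.repr.symm (B.repr z) := (B.repr.symm_apply_apply z).symm
      _ = B.repr.symm (∑ l, Finsupp.single l (zc l)) := by rw [hzc, Finsupp.univ_sum_single]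
      _ = ∑ l, B.repr.symm (Finsupp.single l (zc l)) := map_sum _ _ _
      _ = ∑ l, zc l ⊗ₜ[ℚ] β l := Finset.sum_congr rfl fun l _ => by
          rw [hB, Algebra.TensorProduct.basis_repr_symm_apply, Module.Basis.repr_symm_single_one]
  have hu' : u = ∑ l, algebraMap K (FiniteAdeleRing (𝓞 K) K) (β l) *
      FiniteAdeleRing.mapSemialgHom (𝓞 ℚ) ℚ K (𝓞 K) (zc l) := by
    calc u = ratFiniteAdeleTensorEquiv K z := by rw [hzdef, RingEquiv.apply_symm_apply]
      _ = ∑ l, ratFiniteAdeleTensorEquiv K (zc l ⊗ₜ[ℚ] β l) := by rw [hzsum, map_sum]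
      _ = _ := Finset.sum_congr rfl fun l _ => by rw [ratFiniteAdeleTensorEquiv_tmul]
  have hzl : ∀ l, zc l (HeightOneSpectrum.under (𝓞 ℚ) w) ∈
      (HeightOneSpectrum.under (𝓞 ℚ) w).adicCompletionIntegers ℚ :=
    fun l => (mem_integralFiniteAdeles_iff.1 (hz l)) _
  rw [hu', finiteAdele_sum_apply']
  refine sum_mem fun l _ => ?_
  rw [Literature.NumberTheory.Automorphic.FiniteAdeleRing.mul_apply', FiniteAdeleRing.mapSemialgHom_apply, hβ,
    integralBasis_apply, FiniteAdeleRing.algebraMap_apply]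
  refine mul_mem (coe_algebraMap_mem (𝓞 K) K w (RingOfIntegers.basis K l)) ?_
  exact HeightOneSpectrum.Extension.adicCompletionSemialgHom_image_adicCompletionIntegers ℚ K
    (⟨w, rfl⟩ : (HeightOneSpectrum.under (𝓞 ℚ) w).Extension (𝓞 K)) ⟨zc l (HeightOneSpectrum.under (𝓞 ℚ) w), hzl l, rfl⟩

/-- **`𝓞̂_K = e(ẑ ⊗ 𝓞_K)`**: `u` is integral at every finite place iff all its coordinates in the integral basis lie in `ẑ`.
[cite: CasselsFrohlichANT1967, Ch. II §11 and §14 Lemma (14.2)] -/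
theorem forall_mem_adicCompletionIntegers_iff_forall_repr_mem (u : FiniteAdeleRing (𝓞 K) K) :
    (∀ w : HeightOneSpectrum (𝓞 K), u w ∈ w.adicCompletionIntegers K) ↔
      ∀ k, (Algebra.TensorProduct.basis (FiniteAdeleRing (𝓞 ℚ) ℚ) (integralBasis K)).repr
        ((ratFiniteAdeleTensorEquiv K).symm u) k ∈ integralFiniteAdeles ℚ :=
  ⟨fun hu k => repr_ratFiniteAdeleTensorEquiv_symm_mem_integralFiniteAdeles K hu k,
    fun hz w => mem_adicCompletionIntegers_of_forall_repr_mem K hz w⟩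

/-! ### §3. Any `ℚ`-basis: bounded denominators -/

/-- A finite family of rationals has a common denominator. [cite: CasselsFrohlichANT1967, Ch. II §14] -/
theorem exists_nat_forall_mul_eq_intCast {α : Type*} [Fintype α] (f : α → ℚ) :
    ∃ d : ℕ, d ≠ 0 ∧ ∀ a, ∃ m : ℤ, (d : ℚ) * f a = m := by
  classical
  refine ⟨∏ a, (f a).den, Finset.prod_ne_zero_iff.2 fun a _ => (f a).den_nz, fun a => ?_⟩
  obtain ⟨c, hc⟩ : (f a).den ∣ ∏ a, (f a).den := Finset.dvd_prod_of_mem _ (Finset.mem_univ a)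
  refine ⟨c * (f a).num, ?_⟩
  rw [hc, Nat.cast_mul, Int.cast_mul, mul_comm ((f a).den : ℚ), mul_assoc, Rat.den_mul_eq_num]
  push_cast
  ring


/-- **In ANY `ℚ`-basis the coordinates of integral adèles have BOUNDED DENOMINATORS**: for a `ℚ`-basis `b₁` of `K` there is
`d ≥ 1` with `d · (1 ⊗ b₁)^*_k (e⁻¹ u) ∈ ẑ` for every `u ∈ 𝓞̂_K` and every `k` (§2 in the integral basis, then the rational
change-of-basis matrix `b₁.repr ∘ β`, ★ `Algebra.TensorProduct.basis_repr_tmul`). [cite: CasselsFrohlichANT1967, Ch. II §11 and §14] -/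
theorem exists_nat_mul_repr_ratFiniteAdeleTensorEquiv_symm_mem {κ₁ : Type} [Fintype κ₁] [DecidableEq κ₁]
    (b₁ : Module.Basis κ₁ ℚ K) :
    ∃ d : ℕ, d ≠ 0 ∧ ∀ u : FiniteAdeleRing (𝓞 K) K, (∀ w : HeightOneSpectrum (𝓞 K), u w ∈ w.adicCompletionIntegers K) →
      ∀ k, (d : FiniteAdeleRing (𝓞 ℚ) ℚ) *
        (Algebra.TensorProduct.basis (FiniteAdeleRing (𝓞 ℚ) ℚ) b₁).repr ((ratFiniteAdeleTensorEquiv K).symm u) k ∈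
          integralFiniteAdeles ℚ := by
  classical
  set β := integralBasis K with hβ
  set B := Algebra.TensorProduct.basis (FiniteAdeleRing (𝓞 ℚ) ℚ) β with hB
  set B₁ := Algebra.TensorProduct.basis (FiniteAdeleRing (𝓞 ℚ) ℚ) b₁ with hB₁
  obtain ⟨d, hd0, hd⟩ := exists_nat_forall_mul_eq_intCast
    (fun p : Module.Free.ChooseBasisIndex ℤ (𝓞 K) × κ₁ => b₁.repr (β p.1) p.2)
  refine ⟨d, hd0, fun u hu k => ?_⟩
  set z := (ratFiniteAdeleTensorEquiv K).symm u with hzdef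
  have hz : z = ∑ l, B.repr z l ⊗ₜ[ℚ] β l := by
    calc z = B.repr.symm (B.repr z) := (B.repr.symm_apply_apply z).symm
      _ = B.repr.symm (∑ l, Finsupp.single l (B.repr z l)) := by rw [Finsupp.univ_sum_single]
      _ = ∑ l, B.repr.symm (Finsupp.single l (B.repr z l)) := map_sum _ _ _
      _ = ∑ l, B.repr z l ⊗ₜ[ℚ] β l := Finset.sum_congr rfl fun l _ => by
          rw [hB, Algebra.TensorProduct.basis_repr_symm_apply, Module.Basis.repr_symm_single_one]
  -- change of basis: `B₁.repr z k = Σ_l B.repr z l · (b₁.repr (β l) k)`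
  have hchange : B₁.repr z k = ∑ l, B.repr z l * algebraMap ℚ (FiniteAdeleRing (𝓞 ℚ) ℚ) (b₁.repr (β l) k) := by
    conv_lhs => rw [hz]
    rw [map_sum, Finsupp.coe_finsetSum, Finset.sum_apply]
    refine Finset.sum_congr rfl fun l _ => ?_
    rw [hB₁, Algebra.TensorProduct.basis_repr_tmul, Finsupp.smul_apply, Finsupp.mapRange_apply, smul_eq_mul]
  rw [hchange, Finset.mul_sum]
  refine sum_mem fun l _ => ?_
  obtain ⟨m, hm⟩ := hd (l, k)
  have : (d : FiniteAdeleRing (𝓞 ℚ) ℚ) * (B.repr z l * algebraMap ℚ (FiniteAdeleRing (𝓞 ℚ) ℚ) (b₁.repr (β l) k)) =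
      B.repr z l * algebraMap ℚ (FiniteAdeleRing (𝓞 ℚ) ℚ) (m : ℚ) := by
    rw [← hm, map_mul, map_natCast]; ring
  rw [this]
  exact mul_mem (repr_ratFiniteAdeleTensorEquiv_symm_mem_integralFiniteAdeles K hu l)
    (algebraMap_intCast_mem_integralFiniteAdeles m)

end Literature.NumberTheory.Adeles

end
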